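import Summits.QuantumFields.YangMills.Theorems.FluctuationComparisonRegPrIntLS2BetaWhitneyHatLiftCurvatureSecondOrder
import HarnessLib

/-!
# S2β · (L♭) road, way-out (a) «kinematic» — THE REFINED (F3) LETTER IN THE GLOBAL TWO-PROFILE CURRENCY (`d = 3`):
# all coarse arcs `≤ s ≤ 1∕4`, all coarse chords `≤ F`, all ADJACENT TRANSVERSE parallel variations `≤ v` ⟹ `dist1 (V(∂p)) ≤ (L⁻¹)²·(F + (F + 12s²)² + 40sv + 8v² + 35s³)`

Cell `ym3-torus` (rung R3 = continuum `SU(2)` Yang–Mills on the three-torus — NOT d = 4, NOT infinite volume, NOT a mass gap, NOT Clay).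
Width seat «width 21» `ym3-torus-px21` (gen 23); `--kind proof --supports stmt-QuantumFields-20520 --as helper`, count-neutral, DEFINITION-FREE
(0 `def`, 0 `instance`, 0 `notation`, 0 `sorry`, default heartbeats).  The docking form of ✓`…WhitneyHatLiftCurvatureSecondOrder.dist1_plaqHol_lift_le_second`
(its support-local `Δ` specialised to `2v`): the drop-in replacement of ✓`…WhitneyHatLiftCurvature.dist1_plaqHol_lift_le_of_forall` (`(L⁻¹)²·(F + 24s²)`) for a
TWO-PROFILE `(s, v)` edition of ✓`…RelativeTowerSupProfile.arc_le_sup_step_hatLift` (bookkeeping of that recursion: ✓∕⧗`…ContractingSupVarStart`).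

* §1 the support geometry on the `Setup` torus: `int_eq_of_dvd_of_abs_lt`, ★`coord_eq_add_of_rel` (two coarse sites whose centres are read from the same fine
  coordinate differ by `k` blocks with `(rel − rel′) = k·L`), ★`coord_near_of_rel_lt` (`|rel|, |rel′| < L` ⟹ `k ∈ {−1, 0, 1}`), ★`coord_eq_of_rel_slab`
  (`rel, rel′ ∈ [0, L)` ⟹ equal coordinate).
* §2 `exists_two_other_dirs` (`d = 3`), ★`norm_sub_le_two_mul_of_near` (a parallel log at a site agreeing in the bond direction and within one block transversally is
  within `2v`: two adjacent transverse steps).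
* §3 ★★★`dist1_plaqHol_lift_le_second_of_forall` (`d = 3`): the title.

HONEST SCOPE.  `ℤ∕N` arithmetic and finite bookkeeping over the companion letter; nothing of Bałaban's asserted ([Balaban1985RegularSpaces] (1.29) p.81 served); the `(s, v)`
STEP itself (the variation of the comb-axial correction factors — the located `D_sv` question), the top small-variation gauge, (L♭)'s start, S2β, crux 20520 and
`YM3TorusSU2` are NOT proved; no registered stub is closed; rung R3 = SU(2) YM₃ on T³ — NOT d = 4, NOT infinite volume, NOT a mass gap, NOT Clay; the Yang–Mills mass
gap is NOT proved.  References: T. Bałaban, CMP **99** (1985) 75–102 [Balaban1985RegularSpaces]; CMP **109** (1987) 249–301 [Balaban1987RG1].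
-/

set_option autoImplicit false

namespace Summit.QuantumFields.YangMills.Theorems.FluctuationComparisonRegPrIntLS2BetaWhitneyHatLiftCurvatureSecondOrderGlobal

open Finset
open Literature.MathematicalPhysics.QuantumLattice (su2Quat)
open Literature.MathematicalPhysics.QuantumFieldTheory.Balaban1983to89
open B10Eq27TorusAxialLog (rel rel_apply)
open T4CubeChartGnomonic (SU2)
open T4HaarSU2ExpChart (expPoint)
open T4ExpWindowSmallField (logVec)
open Summit.QuantumFields.YangMills.Theorems.FluctuationComparisonRegPrIntLS2BetaWhitneyHatWeights (emb_apply hatW_support)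
open Summit.QuantumFields.YangMills.Theorems.FluctuationComparisonRegPrIntLS2BetaWhitneyHatCurl (shift_apply_self shift_apply_ne colW_support sum_colW_eq_one)
open Summit.QuantumFields.YangMills.Theorems.FluctuationComparisonRegPrIntLS2BetaWhitneyHatLiftCurvatureSecondOrder (dist1_plaqHol_lift_le_second)

variable {P : Params} {t : ℕ}

/-! ## §1 Support geometry: coarse sites read from the same fine coordinate -/

/-- `L ∣ m`, `|m| < 2L` ⟹ `m ∈ {0, L, −L}`. [folklore] -/
theorem int_eq_of_dvd_of_abs_lt {L m : ℤ} (hL : 0 < L) (hd : L ∣ m) (hm : |m| < 2 * L) : m = 0 ∨ m = L ∨ m = -L := by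
  obtain ⟨k, rfl⟩ := hd
  have h1 : |k| < 2 := by
    rw [abs_mul, abs_of_pos hL] at hm
    by_contra h
    push Not at h
    have : 2 * L ≤ |k| * L := by nlinarith
    linarith [mul_comm L |k|]
  have hk : k = 0 ∨ k = 1 ∨ k = -1 := by
    rcases abs_lt.mp h1 with ⟨h2, h3⟩
    omega
  rcases hk with rfl | rfl | rfl
  · left; ring
  · right; left; ring
  · right; right; ring

/-- ★ **TWO COARSE SITES READ FROM ONE FINE COORDINATE DIFFER BY `k` BLOCKS, `rel − rel′ = k·L`** (standing range; `ℤ∕N` bookkeeping: `N_t = N_{t+1}·L`,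
`centre(y)_κ = y_κ·L + (L−1)∕2`). [folklore] -/
theorem coord_eq_add_of_rel (ht : t + 1 ≤ P.m + P.K) (x : Site P t) (y y' : Site P (t + 1)) (κ : Fin P.d) :
    ∃ k : ℤ, (rel (emb y) x κ : ℤ) - rel (emb y') x κ = k * P.L ∧ y' κ = y κ + (k : ZMod (P.sitesPerDir (t + 1))) := by
  have hN := P.sitesPerDir_eq_mul_succ ht
  have hL : 0 < (P.L : ℤ) := by exact_mod_cast P.L_pos
  set r : ℤ := rel (emb y) x κ with hr
  set r' : ℤ := rel (emb y') x κ with hr'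
  have hc : ((r : ℤ) : ZMod (P.sitesPerDir t)) = x κ - emb y κ := by rw [hr, rel_apply, ZMod.coe_valMinAbs]
  have hc' : ((r' : ℤ) : ZMod (P.sitesPerDir t)) = x κ - emb y' κ := by rw [hr', rel_apply, ZMod.coe_valMinAbs]
  have hdiff : (((r - r' - (((y' κ).val : ℤ) - ((y κ).val : ℤ)) * P.L : ℤ)) : ZMod (P.sitesPerDir t)) = 0 := by
    push_cast
    rw [hc, hc', emb_apply, emb_apply]
    push_cast
    ring
  rw [ZMod.intCast_zmod_eq_zero_iff_dvd, hN] at hdiff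
  push_cast at hdiff
  -- `L ∣ r − r'`, so `r − r' = k·L`
  have hLd : (P.L : ℤ) ∣ r - r' := by
    have h1 : (P.L : ℤ) ∣ (P.sitesPerDir (t + 1) : ℤ) * (P.L : ℤ) := dvd_mul_left _ _
    have h3 : (P.L : ℤ) ∣ (((y' κ).val : ℤ) - ((y κ).val : ℤ)) * P.L := dvd_mul_left _ _
    simpa using (h1.trans hdiff).add h3
  obtain ⟨k, hk⟩ := hLd
  refine ⟨k, by rw [hk]; ring, ?_⟩
  -- cancel `L`: `N' ∣ k − (val y' − val y)`
  have hN' : (P.sitesPerDir (t + 1) : ℤ) ∣ k - (((y' κ).val : ℤ) - ((y κ).val : ℤ)) := by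
    rw [hk, show (P.L : ℤ) * k - (((y' κ).val : ℤ) - ((y κ).val : ℤ)) * P.L = (k - (((y' κ).val : ℤ) - ((y κ).val : ℤ))) * P.L by ring] at hdiff
    exact Int.dvd_of_mul_dvd_mul_right hL.ne' hdiff
  have h0 : (((k - (((y' κ).val : ℤ) - ((y κ).val : ℤ)) : ℤ)) : ZMod (P.sitesPerDir (t + 1))) = 0 :=
    (ZMod.intCast_zmod_eq_zero_iff_dvd _ _).mpr hN'
  push_cast at h0
  rw [ZMod.natCast_zmod_val, ZMod.natCast_zmod_val] at h0
  linear_combination -h0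

/-- ★ **WITHIN ONE BLOCK**: `|rel(centre y, x)_κ| < L` and `|rel(centre y′, x)_κ| < L` ⟹ `y′_κ = y_κ` or `y′_κ = y_κ ± 1`. [folklore] -/
theorem coord_near_of_rel_lt (ht : t + 1 ≤ P.m + P.K) (x : Site P t) (y y' : Site P (t + 1)) (κ : Fin P.d)
    (hy : (rel (emb y) x κ).natAbs < P.L) (hy' : (rel (emb y') x κ).natAbs < P.L) :
    y' κ = y κ ∨ y' κ = y κ + 1 ∨ y κ = y' κ + 1 := by
  have hL : 0 < (P.L : ℤ) := by exact_mod_cast P.L_pos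
  obtain ⟨k, hk, hy'k⟩ := coord_eq_add_of_rel ht x y y' κ
  have hrabs : |(rel (emb y) x κ : ℤ)| < P.L := by
    have : ((rel (emb y) x κ).natAbs : ℤ) < P.L := by exact_mod_cast hy
    rwa [Int.natCast_natAbs] at this
  have hr'abs : |(rel (emb y') x κ : ℤ)| < P.L := by
    have : ((rel (emb y') x κ).natAbs : ℤ) < P.L := by exact_mod_cast hy'
    rwa [Int.natCast_natAbs] at this
  have habs : |k * P.L| < 2 * P.L := by
    rw [← hk]
    have := abs_sub (rel (emb y) x κ : ℤ) (rel (emb y') x κ)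
    linarith
  rcases int_eq_of_dvd_of_abs_lt hL (dvd_mul_left _ _) habs with h | h | h
  · have hk0 : k = 0 := by
      rcases mul_eq_zero.mp h with h0 | h0
      · exact h0
      · exact absurd h0 hL.ne'
    left; rw [hy'k, hk0]; push_cast; ring
  · have hk1 : k = 1 := by
      have : k * (P.L : ℤ) = 1 * P.L := by rw [h, one_mul]
      exact mul_right_cancel₀ hL.ne' this
    right; left; rw [hy'k, hk1]; push_cast; ring
  · have hk1 : k = -1 := by
      have : k * (P.L : ℤ) = (-1) * P.L := by rw [h]; ring
      exact mul_right_cancel₀ hL.ne' this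
    right; right; rw [hy'k, hk1]; push_cast; ring

/-- ★ **SAME SLAB**: `rel(centre y, x)_κ, rel(centre y′, x)_κ ∈ [0, L)` ⟹ `y′_κ = y_κ` (the half-open slab of `x_κ` is unique). [folklore] -/
theorem coord_eq_of_rel_slab (ht : t + 1 ≤ P.m + P.K) (x : Site P t) (y y' : Site P (t + 1)) (κ : Fin P.d)
    (hy0 : 0 ≤ rel (emb y) x κ) (hyL : rel (emb y) x κ < P.L) (hy0' : 0 ≤ rel (emb y') x κ) (hyL' : rel (emb y') x κ < P.L) :
    y' κ = y κ := by
  have hL : 0 < (P.L : ℤ) := by exact_mod_cast P.L_pos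
  obtain ⟨k, hk, hy'k⟩ := coord_eq_add_of_rel ht x y y' κ
  have habs : |k * P.L| < P.L := by
    rw [← hk, abs_lt]; constructor <;> linarith
  have hk0 : k = 0 := by
    by_contra hne
    have h1 : 1 ≤ |k| := Int.one_le_abs hne
    have : (P.L : ℤ) ≤ |k * P.L| := by
      rw [abs_mul, abs_of_pos hL]; nlinarith
    linarith
  rw [hy'k, hk0]; push_cast; ring

/-! ## §2 The path bound at `d = 3` -/

/-- At `d = 3`, besides `μ` there are exactly two directions. [folklore] -/
theorem exists_two_other_dirs (hd : P.d = 3) (μ : Fin P.d) :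
    ∃ ν₁ ν₂ : Fin P.d, ν₁ ≠ μ ∧ ν₂ ≠ μ ∧ ν₁ ≠ ν₂ ∧ ∀ ι : Fin P.d, ι = μ ∨ ι = ν₁ ∨ ι = ν₂ := by
  have hcard : (Finset.univ.erase μ).card = 2 := by
    rw [Finset.card_erase_of_mem (Finset.mem_univ μ), Finset.card_univ, Fintype.card_fin, hd]
  obtain ⟨ν₁, ν₂, hne, h12⟩ := Finset.card_eq_two.mp hcard
  have h1 : ν₁ ∈ Finset.univ.erase μ := by rw [h12]; simp
  have h2 : ν₂ ∈ Finset.univ.erase μ := by rw [h12]; simp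
  refine ⟨ν₁, ν₂, Finset.ne_of_mem_erase h1, Finset.ne_of_mem_erase h2, hne, fun ι => ?_⟩
  by_cases hι : ι = μ
  · exact Or.inl hι
  · have : ι ∈ Finset.univ.erase μ := Finset.mem_erase.mpr ⟨hι, Finset.mem_univ ι⟩
    rw [h12, Finset.mem_insert, Finset.mem_singleton] at this
    exact Or.inr this

/-- One transverse step: if `z` agrees with `y₀` off `ν` and `z_ν ∈ {y₀_ν, y₀_ν ± 1}` then `‖B⟨z, μ⟩ − B⟨y₀, μ⟩‖ ≤ v` (`ν ≠ μ`; adjacent transverse variation `≤ v`).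
[folklore] -/
theorem norm_sub_le_of_transverse_step {E : Type*} [NormedAddCommGroup E] (B : PBond P (t + 1) → E) {v : ℝ} (hv0 : 0 ≤ v)
    (hv : ∀ (y : Site P (t + 1)) (ι κ : Fin P.d), ι ≠ κ → ‖B ⟨y.shift ι, κ⟩ - B ⟨y, κ⟩‖ ≤ v)
    {μ ν : Fin P.d} (hνμ : ν ≠ μ) (z y₀ : Site P (t + 1)) (hoff : ∀ ι, ι ≠ ν → z ι = y₀ ι)
    (hν : z ν = y₀ ν ∨ z ν = y₀ ν + 1 ∨ y₀ ν = z ν + 1) : ‖B ⟨z, μ⟩ - B ⟨y₀, μ⟩‖ ≤ v := by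
  rcases hν with h | h | h
  · have hz : z = y₀ := funext fun ι => by by_cases hι : ι = ν <;> [rw [hι, h]; exact hoff ι hι]
    rw [hz, sub_self, norm_zero]; exact hv0
  · have hz : z = y₀.shift ν := funext fun ι => by
      by_cases hι : ι = ν
      · rw [hι, h, shift_apply_self]
      · rw [shift_apply_ne _ hι, hoff ι hι]
    rw [hz]; exact hv y₀ ν μ hνμ
  · have hz : y₀ = z.shift ν := funext fun ι => by
      by_cases hι : ι = ν
      · rw [hι, h, shift_apply_self]
      · rw [shift_apply_ne _ hι, hoff ι hι]
    rw [norm_sub_rev, hz]; exact hv z ν μ hνμ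

/-- ★ **THE PATH BOUND** (`d = 3`): a parallel `μ`-log at a site agreeing with `y₀` in the `μ`-coordinate and within one block in the two other coordinates is within
`2v` of the one at `y₀` (two adjacent transverse steps). [folklore] -/
theorem norm_sub_le_two_mul_of_near {E : Type*} [NormedAddCommGroup E] (hd : P.d = 3) (B : PBond P (t + 1) → E) {v : ℝ} (hv0 : 0 ≤ v)
    (hv : ∀ (y : Site P (t + 1)) (ι κ : Fin P.d), ι ≠ κ → ‖B ⟨y.shift ι, κ⟩ - B ⟨y, κ⟩‖ ≤ v)
    (μ : Fin P.d) (y y₀ : Site P (t + 1)) (hμ : y μ = y₀ μ)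
    (hnear : ∀ κ, κ ≠ μ → (y κ = y₀ κ ∨ y κ = y₀ κ + 1 ∨ y₀ κ = y κ + 1)) :
    ‖B ⟨y, μ⟩ - B ⟨y₀, μ⟩‖ ≤ 2 * v := by
  classical
  obtain ⟨ν₁, ν₂, h1μ, h2μ, h12, hcov⟩ := exists_two_other_dirs hd μ
  -- intermediate site: move the `ν₁`-coordinate first
  set z : Site P (t + 1) := Function.update y₀ ν₁ (y ν₁) with hz
  have hz1 : z ν₁ = y ν₁ := by rw [hz, Function.update_self]
  have hzoff : ∀ ι, ι ≠ ν₁ → z ι = y₀ ι := fun ι hι => by rw [hz, Function.update_of_ne hι]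
  have step1 : ‖B ⟨z, μ⟩ - B ⟨y₀, μ⟩‖ ≤ v :=
    norm_sub_le_of_transverse_step B hv0 hv h1μ z y₀ hzoff (by rw [hz1]; exact hnear ν₁ h1μ)
  -- then the `ν₂`-coordinate: `y` agrees with `z` off `ν₂`
  have hyoff : ∀ ι, ι ≠ ν₂ → y ι = z ι := fun ι hι => by
    rcases hcov ι with h | h | h
    · rw [h, hμ, hzoff μ h1μ.symm]
    · rw [h, hz1]
    · exact absurd h hι
  have step2 : ‖B ⟨y, μ⟩ - B ⟨z, μ⟩‖ ≤ v :=
    norm_sub_le_of_transverse_step B hv0 hv h2μ y z hyoff (by rw [hzoff ν₂ h12.symm]; exact hnear ν₂ h2μ)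
  calc ‖B ⟨y, μ⟩ - B ⟨y₀, μ⟩‖ = ‖(B ⟨y, μ⟩ - B ⟨z, μ⟩) + (B ⟨z, μ⟩ - B ⟨y₀, μ⟩)‖ := by rw [sub_add_sub_cancel]
    _ ≤ v + v := norm_add_le_of_le step2 step1
    _ = 2 * v := by ring

/-! ## §3 The refined letter, global two-profile form -/

/-- ★★★ **THE REFINED (F3) LETTER, GLOBAL FORM AT `d = 3`**: if every coarse bond has arc `≤ s ≤ 1∕4`, every coarse plaquette chord `dist1 ≤ F`, and every ADJACENT
TRANSVERSE parallel variation `‖log X⟨y + e_ι, κ⟩ − log X⟨y, κ⟩‖ ≤ v` (`ι ≠ κ`), then every fine plaquette of the hat lift has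
    `dist1 (V(∂p)) ≤ (L⁻¹)² · (F + (F + 12s²)² + 40·s·v + 8·v² + 35·s³)`
(✓`dist1_plaqHol_lift_le_second` with `Rμ, Rν` the base-corner logs of a column plaquette and `Δ = 2v` by §1–§2) — the drop-in two-profile replacement of
✓`dist1_plaqHol_lift_le_of_forall`'s `(L⁻¹)²·(F + 24s²)`. [cite: Balaban1985RegularSpaces, (1.29) p.81] -/
theorem dist1_plaqHol_lift_le_second_of_forall (hd : P.d = 3) (ht : t + 1 ≤ P.m + P.K) (w : PBond P t → PBond P (t + 1) → ℝ)
    (hw : ∀ b e, w b e = if e.dir = b.dir ∧ (b.src b.dir - emb e.src b.dir).val < P.L then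
      ∏ ν ∈ Finset.univ.erase b.dir, max 0 (1 - ((rel (emb e.src) b.src ν).natAbs : ℝ) / P.L) else 0)
    (X : GaugeField P (t + 1) SU2) (V : GaugeField P t SU2)
    (hV : ∀ b, V b = expPoint (∑ e, w b e • ((P.L : ℝ)⁻¹ • logVec (su2Quat (X e))))) {s F v : ℝ}
    (hs : ∀ e, ‖logVec (su2Quat (X e))‖ ≤ s) (hs4 : s ≤ 1 / 4) (hF : ∀ q : Plaq P (t + 1), dist1 (GaugeField.plaqHol X q) ≤ F)
    (hv : ∀ (y : Site P (t + 1)) (ι κ : Fin P.d), ι ≠ κ →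
      ‖logVec (su2Quat (X ⟨y.shift ι, κ⟩)) - logVec (su2Quat (X ⟨y, κ⟩))‖ ≤ v)
    (p : Plaq P t) :
    dist1 (GaugeField.plaqHol V p) ≤ ((P.L : ℝ)⁻¹) ^ 2 * (F + (F + 12 * s ^ 2) ^ 2 + 40 * s * v + 8 * v ^ 2 + 35 * s ^ 3) := by
  classical
  -- a column site `y₀` (the column weights sum to one) and its window
  have hsum := sum_colW_eq_one ht p.src p.hμν.ne
  obtain ⟨y₀, -, hy₀⟩ := Finset.exists_ne_zero_of_sum_ne_zero (by rw [hsum]; exact one_ne_zero)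
  have hv0 : 0 ≤ v := (norm_nonneg _).trans (hv y₀ p.μ p.ν p.hμν.ne)
  obtain ⟨⟨g0μ, gLμ⟩, ⟨g0ν, gLν⟩, gκ⟩ := colW_support ht hy₀
  have natAbs_lt_of : ∀ {r : ℤ}, 0 ≤ r → r < P.L → r.natAbs < P.L := fun h0 hL => by
    have := Int.natAbs_lt_natAbs_of_nonneg_of_lt h0 hL
    simpa using this
  have h2v : v ≤ 2 * v := by linarith
  -- the support-local letter with the base-corner logs of `y₀` as references and `Δ := 2v`
  have key := dist1_plaqHol_lift_le_second ht w hw X V hV p (σ := s) (F := F) (Δ := 2 * v)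
    (logVec (su2Quat (X ⟨y₀, p.μ⟩))) (logVec (su2Quat (X ⟨y₀, p.ν⟩))) hs4 (hs _) (fun e _ => hs e) ?_ ?_ ?_
  · refine key.trans (le_of_eq ?_); ring
  · -- `hΔμ`: the `μ`-logs feeding `a⟨x, μ⟩`
    intro e he
    obtain ⟨hdir, ⟨h0, hL'⟩, hoth⟩ := hatW_support ht w hw he
    obtain ⟨y, dir⟩ := e
    change dir = p.μ at hdir
    subst hdir
    refine norm_sub_le_two_mul_of_near hd (fun e => logVec (su2Quat (X e))) hv0 hv p.μ y y₀
      (coord_eq_of_rel_slab ht p.src y₀ y p.μ g0μ gLμ h0 hL') fun κ hκ => ?_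
    have hy0κ : (rel (emb y₀) p.src κ).natAbs < P.L := by
      by_cases hκν : κ = p.ν
      · rw [hκν]; exact natAbs_lt_of g0ν gLν
      · exact gκ κ hκ hκν
    exact coord_near_of_rel_lt ht p.src y₀ y κ hy0κ (hoth κ hκ)
  · -- `hΔν`: the `ν`-logs feeding `a⟨x, ν⟩`
    intro e he
    obtain ⟨hdir, ⟨h0, hL'⟩, hoth⟩ := hatW_support ht w hw he
    obtain ⟨y, dir⟩ := e
    change dir = p.ν at hdir
    subst hdir
    refine norm_sub_le_two_mul_of_near hd (fun e => logVec (su2Quat (X e))) hv0 hv p.ν y y₀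
      (coord_eq_of_rel_slab ht p.src y₀ y p.ν g0ν gLν h0 hL') fun κ hκ => ?_
    have hy0κ : (rel (emb y₀) p.src κ).natAbs < P.L := by
      by_cases hκμ : κ = p.μ
      · rw [hκμ]; exact natAbs_lt_of g0μ gLμ
      · exact gκ κ hκμ hκ
    exact coord_near_of_rel_lt ht p.src y₀ y κ hy0κ (hoth κ hκ)
  · -- `hσy`: the column sites
    intro y hy
    obtain ⟨⟨q0μ, qLμ⟩, ⟨q0ν, qLν⟩, qκ⟩ := colW_support ht hy
    refine ⟨hs _, hs _, hs _, hs _, hF ⟨y, p.μ, p.ν, p.hμν⟩, ?_, ?_, (hv y p.ν p.μ p.hμν.ne').trans h2v, (hv y p.μ p.ν p.hμν.ne).trans h2v⟩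
    · refine norm_sub_le_two_mul_of_near hd (fun e => logVec (su2Quat (X e))) hv0 hv p.μ y y₀
        (coord_eq_of_rel_slab ht p.src y₀ y p.μ g0μ gLμ q0μ qLμ) fun κ hκ => ?_
      by_cases hκν : κ = p.ν
      · rw [hκν]; exact Or.inl (coord_eq_of_rel_slab ht p.src y₀ y p.ν g0ν gLν q0ν qLν)
      · exact coord_near_of_rel_lt ht p.src y₀ y κ (gκ κ hκ hκν) (qκ κ hκ hκν)
    · refine norm_sub_le_two_mul_of_near hd (fun e => logVec (su2Quat (X e))) hv0 hv p.ν y y₀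
        (coord_eq_of_rel_slab ht p.src y₀ y p.ν g0ν gLν q0ν qLν) fun κ hκ => ?_
      by_cases hκμ : κ = p.μ
      · rw [hκμ]; exact Or.inl (coord_eq_of_rel_slab ht p.src y₀ y p.μ g0μ gLμ q0μ qLμ)
      · exact coord_near_of_rel_lt ht p.src y₀ y κ (gκ κ hκμ hκ) (qκ κ hκμ hκ)

end Summit.QuantumFields.YangMills.Theorems.FluctuationComparisonRegPrIntLS2BetaWhitneyHatLiftCurvatureSecondOrderGlobal
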